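import Mathlib.Analysis.Complex.CauchyIntegral
import Mathlib.Analysis.SpecialFunctions.Integrals.Basic
import Mathlib.MeasureTheory.Integral.Bochner.FundThmCalculus
import Mathlib.Analysis.Normed.Group.Bounded
import HarnessLib

/-!
# Fourier coefficients of a `2πi`-periodic entire function; superexponential decay

Topic `Literature/Analysis/Complex`. Everything here is PROVED (no named facts, no definitions).

Let `E` be entire with `E(w + 2πi) = E(w)`. By Cauchy's theorem on the rectangle
`[x₁, x₂] × [0, 2π]` (Mathlib's `Complex.integral_boundary_rect_eq_zero_of_differentiableOn`), whose
horizontal sides cancel by periodicity, the "Fourier–Laurent coefficient integral"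
`J_n(x) = ∫₀^{2π} E(x + iy) e^{n(x+iy)} dy` does not depend on `x`
(`integral_mul_exp_eq_of_periodic`). If on some line `re w = x₀ > 0` the function is a
Dirichlet-type series `E(x₀ + iy) = ∑_m c(m) e^{−m(x₀+iy)}`, orthogonality gives `J_n(x₀) = 2π c(n)`
(`integral_tsum_mul_exp_eq`); moving the line to `x = −X` bounds `|c(n)| ≤ M_X e^{−nX}` with
`M_X = max_{y} |E(−X + iy)|` (`norm_coeff_le_of_periodic_entire`): the coefficients of an
exponential series that continues to a periodic ENTIRE function decay faster than any
exponential — equivalently, `∑ c(m) qᵐ` has infinite radius of convergence. This is the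
classical Laurent-coefficient estimate in the variable `q = e^{−w}`, written without logarithms.

## References

* E. C. Titchmarsh, *The Theory of Functions*, 2nd ed. (1939), §2.5 (Cauchy's inequality for
  Laurent coefficients), §9.1. [folklore]
-/

noncomputable section

open Complex MeasureTheory Set Filter intervalIntegral Real

namespace Literature.Analysis.Complex

/-- **Independence of the coefficient integral of the abscissa.** If `E` is entire and
`2πi`-periodic, then for `n ∈ ℕ` the integral `∫₀^{2π} E(x + iy) e^{n(x+iy)} dy` is the same for
all real `x` (Cauchy–Goursat on `[x₁, x₂] × [0, 2π]`; the horizontal sides cancel since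
`w ↦ E(w) e^{nw}` is `2πi`-periodic). [folklore] -/
theorem integral_mul_exp_eq_of_periodic {E : ℂ → ℂ} (hE : Differentiable ℂ E)
    (hper : ∀ w : ℂ, E (w + 2 * π * I) = E w) (n : ℕ) (x₁ x₂ : ℝ) :
    ∫ y in (0 : ℝ)..2 * π, E (x₁ + y * I) * Complex.exp (n * (x₁ + y * I)) =
      ∫ y in (0 : ℝ)..2 * π, E (x₂ + y * I) * Complex.exp (n * (x₂ + y * I)) := by
  set g : ℂ → ℂ := fun w ↦ E w * Complex.exp (n * w) with hg
  have hgd : Differentiable ℂ g := by rw [hg]; fun_prop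
  have hgper : ∀ w : ℂ, g (w + 2 * π * I) = g w := fun w ↦ by
    simp only [hg]
    rw [hper, mul_add, Complex.exp_add, Complex.exp_nat_mul_two_pi_mul_I, mul_one]
  have h := Complex.integral_boundary_rect_eq_zero_of_differentiableOn g (x₁ : ℂ) (x₂ + 2 * π * I)
    hgd.differentiableOn
  have hre1 : ((x₁ : ℂ)).re = x₁ := Complex.ofReal_re x₁
  have him1 : ((x₁ : ℂ)).im = 0 := Complex.ofReal_im x₁
  have hre2 : ((x₂ : ℂ) + 2 * π * I).re = x₂ := by simp
  have him2 : ((x₂ : ℂ) + 2 * π * I).im = 2 * π := by simp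
  rw [hre1, him1, hre2, him2] at h
  -- the horizontal sides cancel
  have hhor : (∫ x : ℝ in x₁..x₂, g (x + (0 : ℝ) * I)) = ∫ x : ℝ in x₁..x₂, g (x + (2 * π : ℝ) * I) := by
    refine intervalIntegral.integral_congr fun x _ ↦ ?_
    rw [← hgper]
    push_cast
    ring_nf
  rw [hhor, sub_self, zero_add, ← smul_sub, smul_eq_zero] at h
  rcases h with h | h
  · exact absurd h I_ne_zero
  · have := sub_eq_zero.1 h
    simpa [hg] using this.symm

/-- `∫₀^{2π} e^{iky} dy = 0` for a non-zero integer `k`, and `= 2π` for `k = 0`; in the form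
`∫₀^{2π} exp((n − m) i y) dy = if m = n then 2π else 0` for `m n ∈ ℕ`. [folklore] -/
theorem integral_exp_int_sub_mul_I (m n : ℕ) :
    ∫ y in (0 : ℝ)..2 * π, Complex.exp (((n : ℂ) - m) * I * y) =
      if m = n then 2 * π else 0 := by
  split_ifs with h
  · subst h; simp
  · have hk : ((n : ℂ) - m) * I ≠ 0 := by
      refine mul_ne_zero ?_ I_ne_zero
      rw [sub_ne_zero]; exact_mod_cast (Ne.symm h)
    rw [integral_exp_mul_complex hk]
    have e : Complex.exp (((n : ℂ) - m) * I * ↑(2 * π)) = 1 := by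
      have := Complex.exp_int_mul_two_pi_mul_I ((n : ℤ) - m)
      push_cast at this ⊢
      rw [← this]; congr 1; ring
    rw [e]; simp

/-- **Orthogonality.** If `∑_m ‖c(m)‖ e^{−mx} < ∞`, then for `n ∈ ℕ`
`∫₀^{2π} (∑_m c(m) e^{−m(x+iy)}) e^{n(x+iy)} dy = 2π c(n)` (termwise integration). [folklore] -/
theorem integral_tsum_mul_exp_eq {c : ℕ → ℂ} {x : ℝ}
    (hsum : Summable fun m : ℕ ↦ ‖c m‖ * Real.exp (-(m * x))) (n : ℕ) :
    ∫ y in (0 : ℝ)..2 * π, (∑' m : ℕ, c m * Complex.exp (-(m * (x + y * I)))) *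
        Complex.exp (n * (x + y * I)) = 2 * π * c n := by
  have h2π : (0 : ℝ) ≤ 2 * π := by positivity
  set μ : Measure ℝ := volume.restrict (Ioc 0 (2 * π)) with hμ
  haveI : IsFiniteMeasure μ := by rw [hμ]; infer_instance
  -- the terms, with the exponentials combined
  set G : ℕ → ℝ → ℂ := fun m y ↦ c m * Complex.exp (-(m * (x + y * I))) *
    Complex.exp (n * (x + y * I)) with hG
  have hGeq : ∀ m y, G m y = c m * (Real.exp ((n - m : ℝ) * x) : ℂ) *
      Complex.exp (((n : ℂ) - m) * I * y) := by
    intro m y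
    simp only [hG]
    rw [mul_assoc, ← Complex.exp_add, mul_assoc, Complex.ofReal_exp, ← Complex.exp_add]
    congr 2
    push_cast; ring
  have hGnorm : ∀ m y, ‖G m y‖ = ‖c m‖ * Real.exp (-(m * x)) * Real.exp (n * x) := by
    intro m y
    rw [hGeq, norm_mul, norm_mul, Complex.norm_exp, Complex.norm_real, Real.norm_eq_abs,
      abs_of_pos (Real.exp_pos _)]
    have : (((n : ℂ) - m) * I * y).re = 0 := by simp
    rw [this, Real.exp_zero, mul_one, mul_assoc, ← Real.exp_add]
    congr 2; ring
  have hcont : ∀ m, Continuous (G m) := fun m ↦ by rw [hG]; fun_prop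
  have hint : ∀ m, Integrable (G m) μ := fun m ↦
    (integrable_const (‖c m‖ * Real.exp (-(m * x)) * Real.exp (n * x))).mono'
      (hcont m).aestronglyMeasurable (Eventually.of_forall fun y ↦ (hGnorm m y).le)
  have hvol : (μ Set.univ).toReal = 2 * π := by
    rw [hμ, Measure.restrict_apply_univ, Real.volume_Ioc, sub_zero, ENNReal.toReal_ofReal h2π]
  have hsummable : Summable fun m ↦ ∫ y, ‖G m y‖ ∂μ := by
    have : ∀ m, ∫ y, ‖G m y‖ ∂μ = 2 * π * Real.exp (n * x) * (‖c m‖ * Real.exp (-(m * x))) := by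
      intro m
      simp_rw [hGnorm m]
      rw [MeasureTheory.integral_const, smul_eq_mul, Measure.real, hvol]; ring
    simp_rw [this]
    exact hsum.mul_left _
  -- termwise integration
  have hswap : (∫ y in (0 : ℝ)..2 * π, (∑' m : ℕ, c m * Complex.exp (-(m * (x + y * I)))) *
      Complex.exp (n * (x + y * I))) = ∑' m, ∫ y, G m y ∂μ := by
    rw [intervalIntegral.integral_of_le h2π, ← hμ, integral_tsum_of_summable_integral_norm hint hsummable]
    refine integral_congr_ae (Eventually.of_forall fun y ↦ ?_)
    simp only [hG, ← tsum_mul_right]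
  -- each term
  have hterm : ∀ m, ∫ y, G m y ∂μ = if m = n then 2 * π * c n else 0 := by
    intro m
    have e : ∫ y, G m y ∂μ = c m * (Real.exp ((n - m : ℝ) * x) : ℂ) *
        ∫ y in (0 : ℝ)..2 * π, Complex.exp (((n : ℂ) - m) * I * y) := by
      rw [intervalIntegral.integral_of_le h2π, ← hμ, ← MeasureTheory.integral_const_mul]
      exact integral_congr_ae (Eventually.of_forall fun y ↦ hGeq m y)
    rw [e, integral_exp_int_sub_mul_I]
    split_ifs with h
    · subst h
      simp only [sub_self, zero_mul, Real.exp_zero, Complex.ofReal_one, mul_one]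
      push_cast; ring
    · simp
  rw [hswap, tsum_congr hterm, tsum_eq_single n (fun m hm ↦ if_neg hm), if_pos rfl]

/-- **Superexponential decay of the coefficients.** Let `E` be entire and `2πi`-periodic, and
suppose that on the line `re w = 1` it is the exponential series
`E(1 + iy) = ∑_m c(m) e^{−m(1+iy)}` with `∑ ‖c(m)‖ e^{−m} < ∞`. Then for every real `X` there is
`M` with `‖c(n)‖ ≤ M e^{−nX}` for all `n` (take `M = max_{0 ≤ y ≤ 2π} ‖E(−X + iy)‖`: the
coefficient integral on `re w = −X` equals the one on `re w = 1`, which is `2π c(n)`). [folklore] -/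
theorem norm_coeff_le_of_periodic_entire {E : ℂ → ℂ} (hE : Differentiable ℂ E)
    (hper : ∀ w : ℂ, E (w + 2 * π * I) = E w) {c : ℕ → ℂ}
    (hsum : Summable fun m : ℕ ↦ ‖c m‖ * Real.exp (-(m * (1 : ℝ))))
    (hrep : ∀ y : ℝ, E ((1 : ℝ) + y * I) = ∑' m : ℕ, c m * Complex.exp (-(m * ((1 : ℝ) + y * I))))
    (X : ℝ) :
    ∃ M : ℝ, ∀ n : ℕ, ‖c n‖ ≤ M * Real.exp (-(n * X)) := by
  -- `M = sup ‖E‖` on the compact segment `-X + i[0, 2π]`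
  obtain ⟨M, hM⟩ := (isCompact_Icc (a := (0 : ℝ)) (b := 2 * π)).exists_bound_of_continuousOn
    (f := fun y : ℝ ↦ E ((-X : ℝ) + y * I))
    (hE.continuous.comp (by fun_prop : Continuous fun y : ℝ ↦ ((-X : ℝ) : ℂ) + y * I)).continuousOn
  refine ⟨M, fun n ↦ ?_⟩
  have h2π : (0 : ℝ) < 2 * π := by positivity
  -- the coefficient integral on `re w = 1` is `2π c n` ...
  have h1 : ∫ y in (0 : ℝ)..2 * π, E ((1 : ℝ) + y * I) * Complex.exp (n * ((1 : ℝ) + y * I)) =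
      2 * π * c n := by
    rw [← integral_tsum_mul_exp_eq hsum n]
    exact intervalIntegral.integral_congr fun y _ ↦ by simp only [hrep y]
  -- ... and equals the one on `re w = -X`, which is small
  rw [integral_mul_exp_eq_of_periodic hE hper n 1 (-X)] at h1
  have hbound : ‖∫ y in (0 : ℝ)..2 * π, E ((-X : ℝ) + y * I) * Complex.exp (n * ((-X : ℝ) + y * I))‖ ≤
      M * Real.exp (-(n * X)) * |2 * π - 0| := by
    refine norm_integral_le_of_norm_le_const fun y hy ↦ ?_
    rw [uIoc_of_le h2π.le] at hy
    rw [norm_mul, Complex.norm_exp]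
    have hre : ((n : ℂ) * ((-X : ℝ) + y * I)).re = -(n * X) := by
      simp
    rw [hre]
    exact mul_le_mul_of_nonneg_right (hM y ⟨hy.1.le, hy.2⟩) (Real.exp_pos _).le
  rw [h1, sub_zero, abs_of_pos h2π] at hbound
  have h2 : ‖(2 * π : ℂ) * c n‖ = 2 * π * ‖c n‖ := by
    rw [norm_mul, show (2 * π : ℂ) = ((2 * π : ℝ) : ℂ) by simp, Complex.norm_real,
      Real.norm_of_nonneg h2π.le]
  rw [h2] at hbound
  nlinarith [norm_nonneg (c n), Real.exp_pos (-(n * X)), Real.pi_pos]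

end Literature.Analysis.Complex
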